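import Mathlib
import Summits.ValiantsHypothesis.ValiantsHypothesis.Theorems.KPlusLogSqLawWeakLiftingTowerGraftArgumentPrinciple

/-!
# Tower graft line — HOMOTOPY ROUCHÉ and the MATRIX-LEVEL Rouché count for graft determinants `det (F₀ + Q)`

Instrument file for LINE (B) `Cruxes/WeakLifting/Lines/tower_graft.lean` (crux `WeakLifting` = stmt-ValiantsHypothesis-19561), memo
`tower_graft-S5.md` §3 T1 «log-slope localisation» — the T1 INSTRUMENT for far letters of ARBITRARY RANK (the scalar interface of
`…TowerGraftClusterDiscs` / `…TowerGraftSharpCount` covers the corner/rank-one graft `A + X^D·E`).  NO stub is claimed; T1 is an instrument, not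
a typed target (memo §11.2).

§1 HOMOTOPY ROUCHÉ (`card_roots_filter_ball_eq_of_homotopy`).  A family `P_l = Σ_{k ≤ N} l^k · P_k` of complex polynomials, POLYNOMIAL in the real
parameter `l` (the tree's `card_roots_filter_ball_eq_of_norm_lt` is the linear case `P + l·Q` under `‖Q‖ < ‖P‖`): if no `P_l`, `l ∈ [0,1]`, vanishes on
the circle `|τ − c| = R` (`R > 0`), then `P_1` and `P_0` have equally many roots (with multiplicity) in the open disc — the argument-principle integral
`∮ P_l′/P_l = 2πi·N(l)` (tree: `circleIntegral_logDeriv_polynomial`) is continuous in `l` and integer-valued.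
§2 DETERMINANT FAMILIES (`det_add_C_smul_eq_sum`, `card_roots_det_add_eq_of_homotopy`).  For square matrices `F₀`, `Q` over `ℂ[X]`,
`l ↦ det (F₀ + l·Q)` IS such a family (coefficients = the `Y`-coefficients of `det (F₀ + Y·Q) ∈ ℂ[X][Y]`), so: if `det (F₀(τ) + l·Q(τ)) ≠ 0` for all
`l ∈ [0,1]` and all `τ` on the circle — e.g. when `F₀(τ)` DOMINATES `Q(τ)` there as an operator — then `det (F₀ + Q)` and `det F₀` have equally many
roots in the disc.  READING FOR THE LINE: for a graft `G + X^D·S` of ANY rank, in every disc of the base-dominant zone the crossings of the graft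
are charged ONE-FOR-ONE (with multiplicity) to zeros of the CLASS DETERMINANT `det G` alone — no digit bookkeeping, no residual; what is charged
outside that zone (the top window, the `S`-dominant zone where `det (X^D·S + l·G)` is the right homotopy) is not addressed here.
HONEST FRAMING: classical complex analysis; nothing on S4/S4b/S5, TowerB, `WeakLifting`, Conjecture B, 18050 or VP ≠ VNP.  Def-free; Mathlib + the
tree's argument-principle file.  Seat: prover val-sym-lift-p2 g22, `--supports stmt-ValiantsHypothesis-19561 --as helper`.
-/

-- `Summit.ValiantsHypothesis.ValiantsHypothesis.…` repeats a component by the D-0017 layout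
-- (single-conjunct summit), which the `dupNamespace` linter flags; the name is mandated.
set_option linter.dupNamespace false

namespace Summit.ValiantsHypothesis.ValiantsHypothesis.Theorems.KPlusLogSqLaw.TowerGraft

open Polynomial Complex MeasureTheory
open scoped BigOperators Polynomial Real

/-! ## §1 Homotopy Rouché for a family of polynomials that is polynomial in the parameter -/

section Homotopy

/-- evaluation of the family `Σ_{k<N} C(l^k)·P_k` at `τ`. [folklore] -/
theorem eval_sum_C_pow_mul (P : ℕ → ℂ[X]) (N : ℕ) (l : ℝ) (τ : ℂ) :
    (∑ k ∈ Finset.range N, C ((l : ℂ) ^ k) * P k).eval τ = ∑ k ∈ Finset.range N, (l : ℂ) ^ k * (P k).eval τ := by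
  rw [eval_finsetSum]
  exact Finset.sum_congr rfl fun k _ => by rw [eval_mul, eval_C]

/-- derivative of the family. [folklore] -/
theorem derivative_sum_C_pow_mul (P : ℕ → ℂ[X]) (N : ℕ) (l : ℝ) :
    derivative (∑ k ∈ Finset.range N, C ((l : ℂ) ^ k) * P k) = ∑ k ∈ Finset.range N, C ((l : ℂ) ^ k) * derivative (P k) := by
  rw [derivative_sum]
  exact Finset.sum_congr rfl fun k _ => by rw [derivative_mul, derivative_C, zero_mul, zero_add]

/-- joint continuity of `(l, θ) ↦ Σ l^k · P_k(γ(θ))` along the circle. [folklore] -/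
theorem continuous_eval_family_circle (P : ℕ → ℂ[X]) (N : ℕ) (c : ℂ) (R : ℝ) :
    Continuous fun p : Set.Icc (0 : ℝ) 1 × ℝ =>
      (∑ k ∈ Finset.range N, C (((p.1 : ℝ) : ℂ) ^ k) * P k).eval (circleMap c R p.2) := by
  have h : (fun p : Set.Icc (0 : ℝ) 1 × ℝ => (∑ k ∈ Finset.range N, C (((p.1 : ℝ) : ℂ) ^ k) * P k).eval (circleMap c R p.2)) =
      fun p => ∑ k ∈ Finset.range N, (((p.1 : ℝ) : ℂ) ^ k) * (P k).eval (circleMap c R p.2) := by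
    funext p; exact eval_sum_C_pow_mul P N p.1 _
  rw [h]
  refine continuous_finsetSum _ fun k _ => ?_
  have hl : Continuous fun p : Set.Icc (0 : ℝ) 1 × ℝ => ((p.1 : ℝ) : ℂ) :=
    Complex.continuous_ofReal.comp (continuous_subtype_val.comp continuous_fst)
  have hγ : Continuous fun p : Set.Icc (0 : ℝ) 1 × ℝ => circleMap c R p.2 := (continuous_circleMap c R).comp continuous_snd
  exact (hl.pow k).mul ((P k).continuous.comp hγ)

/-- **HOMOTOPY ROUCHÉ FOR POLYNOMIALS ON A DISC.**  Let `P_l = Σ_{k<N} l^k·P_k` (`l ∈ ℝ`) be a family of complex polynomials, polynomial in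
the parameter.  If `P_l(τ) ≠ 0` for every `l ∈ [0,1]` and every `τ` on the circle `|τ − c| = R` (`R > 0`), then `P_1` and `P_0` have the same
number of roots (with multiplicity) in the open disc. [folklore; the tree's `card_roots_filter_ball_eq_of_norm_lt` is the linear case] -/
theorem card_roots_filter_ball_eq_of_homotopy (P : ℕ → ℂ[X]) (N : ℕ) (c : ℂ) {R : ℝ} (hR : 0 < R)
    (hne : ∀ l : ℝ, 0 ≤ l → l ≤ 1 → ∀ τ ∈ Metric.sphere c R, (∑ k ∈ Finset.range N, C ((l : ℂ) ^ k) * P k).eval τ ≠ 0) :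
    Multiset.card ((∑ k ∈ Finset.range N, C ((1 : ℝ) : ℂ) ^ k * P k).roots.filter fun z => dist z c < R) =
      Multiset.card ((∑ k ∈ Finset.range N, C ((0 : ℝ) : ℂ) ^ k * P k).roots.filter fun z => dist z c < R) := by
  set Pl : ℝ → ℂ[X] := fun l => ∑ k ∈ Finset.range N, C ((l : ℂ) ^ k) * P k with hPl
  have hC : ∀ l : ℝ, (∑ k ∈ Finset.range N, C ((l : ℝ) : ℂ) ^ k * P k) = Pl l := by
    intro l; simp only [hPl, map_pow]
  rw [hC 1, hC 0]
  have hsome : (c + R : ℂ) ∈ Metric.sphere c R := by simp [abs_of_pos hR]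
  have hPl0 : ∀ l : ℝ, 0 ≤ l → l ≤ 1 → Pl l ≠ 0 := by
    intro l hl0 hl1 h0
    exact hne l hl0 hl1 _ hsome (by simp only [hPl] at h0 ⊢; rw [h0, eval_zero])
  have hroots : ∀ l : ℝ, 0 ≤ l → l ≤ 1 → ∀ z ∈ (Pl l).roots, z ∉ Metric.sphere c R := by
    intro l hl0 hl1 z hz hzs
    exact hne l hl0 hl1 z hzs ((Polynomial.mem_roots (hPl0 l hl0 hl1)).mp hz)
  set Nr : ℝ → ℕ := fun l => Multiset.card ((Pl l).roots.filter fun z => dist z c < R) with hNr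
  have hint : ∀ l : ℝ, 0 ≤ l → l ≤ 1 →
      (∮ τ in C(c, R), (Pl l).derivative.eval τ / (Pl l).eval τ) = 2 * π * I * (Nr l : ℂ) :=
    fun l hl0 hl1 => circleIntegral_logDeriv_polynomial (Pl l) (hPl0 l hl0 hl1) c hR.le (hroots l hl0 hl1)
  -- continuity of the circle integral in `l ∈ [0,1]`
  have hcont : ContinuousOn (fun l : ℝ => ∮ τ in C(c, R), (Pl l).derivative.eval τ / (Pl l).eval τ) (Set.Icc 0 1) := by
    rw [continuousOn_iff_continuous_restrict]
    have hF : Continuous (Function.uncurry fun (x : Set.Icc (0 : ℝ) 1) (θ : ℝ) =>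
        deriv (circleMap c R) θ • ((Pl x.1).derivative.eval (circleMap c R θ) / (Pl x.1).eval (circleMap c R θ))) := by
      have hnum : Continuous fun p : Set.Icc (0 : ℝ) 1 × ℝ => (Pl p.1.1).derivative.eval (circleMap c R p.2) := by
        have : (fun p : Set.Icc (0 : ℝ) 1 × ℝ => (Pl p.1.1).derivative.eval (circleMap c R p.2)) =
            fun p => (∑ k ∈ Finset.range N, C (((p.1 : ℝ) : ℂ) ^ k) * derivative (P k)).eval (circleMap c R p.2) := by
          funext p; simp only [hPl]; rw [derivative_sum_C_pow_mul]
        rw [this]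
        exact continuous_eval_family_circle (fun k => derivative (P k)) N c R
      have hden : Continuous fun p : Set.Icc (0 : ℝ) 1 × ℝ => (Pl p.1.1).eval (circleMap c R p.2) :=
        continuous_eval_family_circle P N c R
      have hden0 : ∀ p : Set.Icc (0 : ℝ) 1 × ℝ, (Pl p.1.1).eval (circleMap c R p.2) ≠ 0 :=
        fun p => hne p.1.1 p.1.2.1 p.1.2.2 _ (circleMap_mem_sphere c hR.le p.2)
      have hder : Continuous fun p : Set.Icc (0 : ℝ) 1 × ℝ => deriv (circleMap c R) p.2 := by
        have : (fun p : Set.Icc (0 : ℝ) 1 × ℝ => deriv (circleMap c R) p.2) = fun p => circleMap 0 R p.2 * I := by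
          funext p; rw [deriv_circleMap]
        rw [this]
        exact ((continuous_circleMap 0 R).comp continuous_snd).mul continuous_const
      exact hder.smul (hnum.div hden hden0)
    exact intervalIntegral.continuous_parametric_intervalIntegral_of_continuous' (μ := volume) hF 0 (2 * π)
  -- the normalised difference is continuous, integer-valued on `[0,1]`, and vanishes at `0`
  set φ : ℝ → ℝ := fun l => ‖(∮ τ in C(c, R), (Pl l).derivative.eval τ / (Pl l).eval τ) -
      (∮ τ in C(c, R), (Pl 0).derivative.eval τ / (Pl 0).eval τ)‖ / (2 * π) with hφ
  have hφcont : ContinuousOn φ (Set.Icc 0 1) :=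
    ContinuousOn.div_const (ContinuousOn.norm (hcont.sub continuousOn_const)) _
  have hφval : ∀ l : ℝ, 0 ≤ l → l ≤ 1 → φ l = |((Nr l : ℝ) - Nr 0)| := by
    intro l hl0 hl1
    simp only [hφ]
    rw [hint l hl0 hl1, hint 0 le_rfl zero_le_one, ← mul_sub, norm_mul]
    have h2pi : ‖(2 * π * I : ℂ)‖ = 2 * π := by
      simp [Complex.norm_real, Real.norm_eq_abs, abs_of_pos Real.pi_pos]
    rw [h2pi, ← Complex.ofReal_natCast, ← Complex.ofReal_natCast, ← Complex.ofReal_sub, Complex.norm_real,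
      Real.norm_eq_abs]
    field_simp
  have hφint : ∀ l : ℝ, 0 ≤ l → l ≤ 1 → ∃ k : ℤ, φ l = k := by
    intro l hl0 hl1
    refine ⟨|((Nr l : ℤ) - Nr 0)|, ?_⟩
    rw [hφval l hl0 hl1]
    push_cast
    ring_nf
  have hφ0 : φ 0 = 0 := by rw [hφval 0 le_rfl zero_le_one]; simp
  by_contra hneq
  have hφ1 : 1 ≤ φ 1 := by
    rw [hφval 1 zero_le_one le_rfl]
    have hz : ((Nr 1 : ℤ) - Nr 0) ≠ 0 := by
      intro h; apply hneq
      have h01 : (Nr 1 : ℤ) = Nr 0 := by linarith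
      have h1 : Nr 1 = Nr 0 := by exact_mod_cast h01
      simpa [hNr] using h1
    have h2 : (1 : ℤ) ≤ |((Nr 1 : ℤ) - Nr 0)| := Int.one_le_abs hz
    have h3 : ((1 : ℤ) : ℝ) ≤ ((|((Nr 1 : ℤ) - Nr 0)| : ℤ) : ℝ) := Int.cast_le.mpr h2
    rw [Int.cast_abs] at h3
    push_cast at h3
    exact h3
  obtain ⟨l, hl, hlφ⟩ : ∃ l ∈ Set.Icc (0 : ℝ) 1, φ l = 1 / 2 := by
    have hmem : (1 / 2 : ℝ) ∈ Set.Icc (φ 0) (φ 1) := by rw [hφ0]; constructor <;> linarith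
    exact intermediate_value_Icc zero_le_one hφcont hmem
  obtain ⟨k, hk⟩ := hφint l hl.1 hl.2
  rw [hk] at hlφ
  have h2 : (2 * k : ℤ) = 1 := by
    have : (2 * k : ℝ) = 1 := by linarith
    exact_mod_cast this
  omega

end Homotopy

/-! ## §2 Determinants of matrix families `F₀ + l·Q` are polynomial in `l`; the matrix-level Rouché count -/

section Det

variable {n : Type*} [Fintype n] [DecidableEq n]

/-- **the determinant family is polynomial in the parameter.**  For square `F₀`, `Q` over `ℂ[X]` there are polynomials `P_k` (the
`Y`-coefficients of `det (F₀ + Y·Q) ∈ ℂ[X][Y]`) and a bound `N` with `det (F₀ + C(l)·Q) = Σ_{k<N} C(l^k)·P_k` for every complex `l`. [folklore] -/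
theorem det_add_C_smul_eq_sum (F₀ Q : Matrix n n ℂ[X]) :
    ∃ (N : ℕ) (P : ℕ → ℂ[X]), ∀ l : ℂ, (F₀ + C l • Q).det = ∑ k ∈ Finset.range N, C (l ^ k) * P k := by
  classical
  -- the bivariate determinant
  set M : Matrix n n (Polynomial ℂ[X]) := F₀.map Polynomial.C + (Polynomial.X : Polynomial ℂ[X]) • Q.map Polynomial.C with hM
  set D : Polynomial ℂ[X] := M.det with hD
  refine ⟨D.natDegree + 1, fun k => D.coeff k, fun l => ?_⟩
  -- evaluate the outer variable at the constant `C l`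
  have heval : (F₀ + C l • Q) = M.map (Polynomial.eval (C l)) := by
    ext i j
    simp only [hM, Matrix.map_apply, Matrix.add_apply, Matrix.smul_apply, smul_eq_mul, Polynomial.eval_add,
      Polynomial.eval_mul, Polynomial.eval_C, Polynomial.eval_X]
  have hdet : (F₀ + C l • Q).det = D.eval (C l) := by
    rw [heval, hD, ← Polynomial.coe_evalRingHom, ← RingHom.mapMatrix_apply, ← RingHom.map_det, Polynomial.coe_evalRingHom]
  rw [hdet, Polynomial.eval_eq_sum_range]
  exact Finset.sum_congr rfl fun k _ => by rw [mul_comm, map_pow]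

/-- **MATRIX-LEVEL ROUCHÉ COUNT.**  `F₀`, `Q` square over `ℂ[X]`, `R > 0`.  If along the homotopy `F₀ + l·Q`, `l ∈ [0,1]`, the determinant
never vanishes on the circle `|τ − c| = R`, then `det (F₀ + Q)` and `det F₀` have the same number of roots (with multiplicity) in the open
disc: every root of the perturbed determinant in the disc is charged one-for-one to a root of `det F₀`. [this work] -/
theorem card_roots_det_add_eq_of_homotopy (F₀ Q : Matrix n n ℂ[X]) (c : ℂ) {R : ℝ} (hR : 0 < R)
    (hne : ∀ l : ℝ, 0 ≤ l → l ≤ 1 → ∀ τ ∈ Metric.sphere c R, ((F₀ + C (l : ℂ) • Q).det).eval τ ≠ 0) :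
    Multiset.card ((F₀ + Q).det.roots.filter fun z => dist z c < R) =
      Multiset.card (F₀.det.roots.filter fun z => dist z c < R) := by
  obtain ⟨N, P, hP⟩ := det_add_C_smul_eq_sum F₀ Q
  have h1 : (F₀ + Q).det = ∑ k ∈ Finset.range N, C ((1 : ℝ) : ℂ) ^ k * P k := by
    have := hP 1
    rw [map_one, one_smul] at this
    rw [this]
    exact Finset.sum_congr rfl fun k _ => by simp
  have h0 : F₀.det = ∑ k ∈ Finset.range N, C ((0 : ℝ) : ℂ) ^ k * P k := by
    have := hP 0
    rw [map_zero, zero_smul, add_zero] at this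
    rw [this]
    exact Finset.sum_congr rfl fun k _ => by simp
  rw [h1, h0]
  refine card_roots_filter_ball_eq_of_homotopy P N c hR fun l hl0 hl1 τ hτ => ?_
  have := hne l hl0 hl1 τ hτ
  rwa [hP (l : ℂ), show (∑ k ∈ Finset.range N, C ((l : ℂ) ^ k) * P k) = ∑ k ∈ Finset.range N, C ((l : ℂ) ^ k) * P k from rfl] at this

end Det

/-! ## §3 Real grafts: positive roots of `det (F₀ + Q)` charged to the roots of `det F₀` in a disc system -/

section RealGraft

variable {n : Type*} [Fintype n] [DecidableEq n]

/-- complexification commutes with the determinant. [folklore] -/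
theorem det_map_ofReal (F₀ : Matrix n n ℝ[X]) :
    (F₀.det).map Complex.ofRealHom = (F₀.map (Polynomial.map Complex.ofRealHom)).det := by
  have h := RingHom.map_det (Polynomial.mapRingHom Complex.ofRealHom) F₀
  rw [RingHom.mapMatrix_apply, Polynomial.coe_mapRingHom] at h
  exact h

/-- complexification commutes with the determinant of a sum. [folklore] -/
theorem det_map_ofReal_add (F₀ Q : Matrix n n ℝ[X]) :
    ((F₀ + Q).det).map Complex.ofRealHom =
      (F₀.map (Polynomial.map Complex.ofRealHom) + Q.map (Polynomial.map Complex.ofRealHom)).det := by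
  rw [det_map_ofReal, Matrix.map_add _ (fun a b => Polynomial.map_add Complex.ofRealHom)]

/-- **ONE DISC**: the positive roots of `det (F₀ + Q)` lying in a disc on whose circle the homotopy `det (F₀ + l·Q)` (complexified) never
vanishes number at most the roots of `det F₀` in that disc, with multiplicity. [this work] -/
theorem card_posRoots_det_add_le_in_disc (F₀ Q : Matrix n n ℝ[X]) (c : ℂ) {R : ℝ} (hR : 0 < R)
    (hne : ∀ l : ℝ, 0 ≤ l → l ≤ 1 → ∀ τ ∈ Metric.sphere c R,
      ((F₀.map (Polynomial.map Complex.ofRealHom) + C (l : ℂ) • Q.map (Polynomial.map Complex.ofRealHom)).det).eval τ ≠ 0)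
    (T : Finset ℝ) (hT : ∀ t ∈ T, dist (t : ℂ) c < R ∧ ((F₀ + Q).det).eval t = 0) :
    T.card ≤ Multiset.card (((F₀.det).map Complex.ofRealHom).roots.filter fun z => dist z c < R) := by
  classical
  set F₀c := F₀.map (Polynomial.map Complex.ofRealHom) with hF₀c
  set Qc := Q.map (Polynomial.map Complex.ofRealHom) with hQc
  set hc : ℂ[X] := ((F₀ + Q).det).map Complex.ofRealHom with hhc
  have hhc' : hc = (F₀c + Qc).det := det_map_ofReal_add F₀ Q
  have hcount := card_roots_det_add_eq_of_homotopy F₀c Qc c hR hne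
  -- `hc ≠ 0`: it does not vanish on the circle (`l = 1`)
  have hhc0 : hc ≠ 0 := by
    intro h0
    obtain ⟨τ, hτ⟩ : (Metric.sphere c R).Nonempty := (NormedSpace.sphere_nonempty).mpr hR.le
    have := hne 1 zero_le_one le_rfl τ hτ
    rw [Complex.ofReal_one, map_one, one_smul, ← hhc', h0, eval_zero] at this
    exact this rfl
  have hev : ∀ x : ℝ, hc.eval (x : ℂ) = ((((F₀ + Q).det).eval x : ℝ) : ℂ) := fun x => by
    rw [hhc, Polynomial.eval_map, ← Complex.ofRealHom_eq_coe, Polynomial.eval₂_at_apply, Complex.ofRealHom_eq_coe]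
  set T' : Finset ℂ := T.image fun t : ℝ => (t : ℂ) with hT'
  have hsub : T' ⊆ (hc.roots.filter fun z => dist z c < R).toFinset := by
    intro x hx
    rw [hT', Finset.mem_image] at hx
    obtain ⟨t, ht, rfl⟩ := hx
    obtain ⟨hdist, hzt⟩ := hT t ht
    rw [Multiset.mem_toFinset, Multiset.mem_filter, Polynomial.mem_roots hhc0, Polynomial.IsRoot.def, hev, hzt,
      Complex.ofReal_zero]
    exact ⟨rfl, hdist⟩
  calc T.card = T'.card := (Finset.card_image_of_injective _ Complex.ofReal_injective).symm
    _ ≤ (hc.roots.filter fun z => dist z c < R).toFinset.card := Finset.card_le_card hsub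
    _ ≤ Multiset.card (hc.roots.filter fun z => dist z c < R) := Multiset.toFinset_card_le _
    _ = Multiset.card ((F₀c + Qc).det.roots.filter fun z => dist z c < R) := by rw [hhc']
    _ = Multiset.card (F₀c.det.roots.filter fun z => dist z c < R) := hcount
    _ = Multiset.card (((F₀.det).map Complex.ofRealHom).roots.filter fun z => dist z c < R) := by rw [det_map_ofReal F₀]

/-- **MATRIX-LEVEL T1 INTERFACE.**  `F₀`, `Q` real square matrix polynomials (for the line: `F₀ = G` a class pencil, `Q = X^D·S` a far letter
of ANY rank); a finite disc system `B(ctr i, rad i)` such that (HOMOTOPY) on every circle the complexified `det (F₀ + l·Q)`, `l ∈ [0,1]`, never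
vanishes, and (COVERAGE) every positive root of `det (F₀ + Q)` lies in some disc.  Then
`Z₊(det (F₀ + Q)) ≤ Σᵢ #{roots of det F₀ in disc i, with multiplicity}` — every crossing is charged to a root of the BASE determinant alone.
[this work] -/
theorem card_posRoots_det_add_le_sum_discs (F₀ Q : Matrix n n ℝ[X]) {ι : Type*} (I : Finset ι) (ctr : ι → ℂ) (rad : ι → ℝ)
    (hrad : ∀ i ∈ I, 0 < rad i)
    (hne : ∀ i ∈ I, ∀ l : ℝ, 0 ≤ l → l ≤ 1 → ∀ τ ∈ Metric.sphere (ctr i) (rad i),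
      ((F₀.map (Polynomial.map Complex.ofRealHom) + C (l : ℂ) • Q.map (Polynomial.map Complex.ofRealHom)).det).eval τ ≠ 0)
    (hcov : ∀ t : ℝ, 0 < t → ((F₀ + Q).det).eval t = 0 → ∃ i ∈ I, dist (t : ℂ) (ctr i) < rad i) :
    (((F₀ + Q).det).roots.toFinset.filter (fun t => 0 < t)).card ≤
      ∑ i ∈ I, Multiset.card (((F₀.det).map Complex.ofRealHom).roots.filter fun z => dist z (ctr i) < rad i) := by
  classical
  set Z := ((F₀ + Q).det).roots.toFinset.filter (fun t => 0 < t) with hZ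
  have hmem : ∀ t ∈ Z, 0 < t ∧ ((F₀ + Q).det).eval t = 0 := by
    intro t ht
    rw [hZ, Finset.mem_filter, Multiset.mem_toFinset] at ht
    exact ⟨ht.2, (Polynomial.mem_roots'.mp ht.1).2⟩
  have hsub : Z ⊆ I.biUnion fun i => Z.filter fun t : ℝ => dist (t : ℂ) (ctr i) < rad i := by
    intro t ht
    obtain ⟨hpos, hzt⟩ := hmem t ht
    obtain ⟨i, hi, hdist⟩ := hcov t hpos hzt
    rw [Finset.mem_biUnion]
    exact ⟨i, hi, Finset.mem_filter.mpr ⟨ht, hdist⟩⟩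
  calc Z.card ≤ (I.biUnion fun i => Z.filter fun t : ℝ => dist (t : ℂ) (ctr i) < rad i).card := Finset.card_le_card hsub
    _ ≤ ∑ i ∈ I, (Z.filter fun t : ℝ => dist (t : ℂ) (ctr i) < rad i).card := Finset.card_biUnion_le
    _ ≤ ∑ i ∈ I, Multiset.card (((F₀.det).map Complex.ofRealHom).roots.filter fun z => dist z (ctr i) < rad i) := by
      refine Finset.sum_le_sum fun i hi => ?_
      refine card_posRoots_det_add_le_in_disc F₀ Q (ctr i) (hrad i hi) (hne i hi) _ fun t ht => ?_
      rw [Finset.mem_filter] at ht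
      exact ⟨ht.2, (hmem t ht.1).2⟩

end RealGraft

end Summit.ValiantsHypothesis.ValiantsHypothesis.Theorems.KPlusLogSqLaw.TowerGraft
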